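import Literature.Probability.RandomPlanarGeometry.ConformalRemovabilityDescendants
import HarnessLib

/-!
# Conformal removability: the shadow-size function of Jones–Smirnov's Theorem 2

Support for the proof of `JonesSmirnov2000_frontier_of_isHolderDomain` (Jones–Smirnov 2000,
Cor. 2; `ConformalRemovability.lean`), continuing `ConformalRemovabilityRays.lean` and
`ConformalRemovabilityDescendants.lean` (same abstract rooted graph). The heart of the proof of
Theorem 2 (P. W. Jones, S. K. Smirnov, Ark. Mat. 38 (2000), §3, pp. 274–275) bounds the shadows:
"for every cube `Q ∈ W` find a curve from `Γ` going through it, such that its length is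
comparable to `s(Q)`", `s(Q) ≲ Σ_j l(Q_j)` along that curve, and then, by Hölder's inequality and
the fact that "a given cube `Q̃` is shadowed by exactly `q(Q̃)` cubes",
`Σ_Q s(Q)ⁿ ≲ Σ_Q l(Q)ⁿ q(Q)ⁿ` (the displayed computation on p. 275).

Here the role of `s(Q)` is played by the TAIL SUPREMUM `τ v` = the supremum of `Σ_i rad (c i)`
over all finite chains `c` starting at `v` (every landing point of a ray through `v` lies within
`2κ τ v` of `pos v`). This file (first part) characterises `τ` abstractly — as any function with
the least-upper-bound property `hτ` — and proves the recursion along the GREEDY child `g`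
(a child maximising `τ`, hypothesis `hg`):

* `rad_le_of_isLUB`, `le_sqrt_mul_of_isLUB` — `rad v ≤ τ v ≤ √M √(2/(q v + 1))`;
* `rad_add_le_of_isLUB` (children: `rad v + τ w ≤ τ v`), `le_rad_add_of_isLUB`;
* `eq_sum_add_iterate_of_isLUB` — `τ v = Σ_{j<n} rad (g^[j] v) + τ (g^[n] v)` while children exist;
* `hasSum_indicator_of_isLUB` — `τ v = Σ_j rad (g^[j] v)` summed over the greedy chain (finite or
  infinite), written with the indicator of the set of "active" indices;
* `one_div_mul_sqrt_le`, `one_div_sqrt_le`, `sum_range_one_div_mul_sqrt_le`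
  (`Σ_{j<n} ((m+1+j)√(m+1+j))⁻¹ ≤ 3/√(m+1)`), `sum_range_one_div_sqrt_le`
  (`Σ_{l ≤ n} (√(l+1))⁻¹ ≤ 2 √(n+1)`) — the elementary (telescoping) inequalities used in the
  Hölder step of the sequel `ConformalRemovabilityShadowSum.lean`.

## References

* [JonesSmirnov2000] P. W. Jones, S. K. Smirnov, *Removability theorems for Sobolev functions and
  quasiconformal maps*, Ark. Mat. 38 (2000) 263–279, §3, proof of Thm. 2 (pp. 274–275).
-/

noncomputable section

open Set Filter Finset Metric
open scoped Topology BigOperators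

namespace Literature.Probability.RandomPlanarGeometry

section TailSup

variable {V : Type*} {root : V} {parent : V → V} {q : V → ℕ} {rad : V → ℝ} {τ : V → ℝ}
  {g : V → V}

/-- `rad v ≤ τ v` (the one-vertex chain). [folklore] -/
theorem rad_le_of_isLUB
    (hτ : ∀ v, IsLUB {s : ℝ | ∃ (m : ℕ) (c : ℕ → V), c 0 = v ∧ (∀ i < m, parent (c (i + 1)) = c i) ∧
      (∀ i < m, c (i + 1) ≠ root) ∧ s = ∑ i ∈ range (m + 1), rad (c i)} (τ v)) (v : V) :
    rad v ≤ τ v :=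
  (hτ v).1 ⟨0, fun _ => v, rfl, fun i hi => (Nat.not_lt_zero i hi).elim,
    fun i hi => (Nat.not_lt_zero i hi).elim, by simp⟩

/-- `τ v ≤ √(Σ_u (q u+1)² rad u²) √(2/(q v + 1))` (Cauchy–Schwarz on every chain,
`sum_rad_chain_le`). [cite: JonesSmirnov2000, §3 proof of Thm. 2 (p. 274)] -/
theorem le_sqrt_mul_of_isLUB (hq : ∀ v, v ≠ root → q v = q (parent v) + 1)
    (hrad : ∀ v, 0 ≤ rad v) (hsum : Summable fun v => ((q v : ℝ) + 1) ^ 2 * rad v ^ 2)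
    (hτ : ∀ v, IsLUB {s : ℝ | ∃ (m : ℕ) (c : ℕ → V), c 0 = v ∧ (∀ i < m, parent (c (i + 1)) = c i) ∧
      (∀ i < m, c (i + 1) ≠ root) ∧ s = ∑ i ∈ range (m + 1), rad (c i)} (τ v)) (v : V) :
    τ v ≤ Real.sqrt (∑' u, ((q u : ℝ) + 1) ^ 2 * rad u ^ 2) * Real.sqrt (2 / ((q v : ℝ) + 1)) := by
  refine (hτ v).2 ?_
  rintro s ⟨m, c, hc0v, hc, hc0, rfl⟩
  have := sum_rad_chain_le hq hc hc0 hrad hsum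
  rwa [hc0v] at this

/-- `τ` is nonnegative. [folklore] -/
theorem nonneg_of_isLUB (hrad : ∀ v, 0 ≤ rad v)
    (hτ : ∀ v, IsLUB {s : ℝ | ∃ (m : ℕ) (c : ℕ → V), c 0 = v ∧ (∀ i < m, parent (c (i + 1)) = c i) ∧
      (∀ i < m, c (i + 1) ≠ root) ∧ s = ∑ i ∈ range (m + 1), rad (c i)} (τ v)) (v : V) :
    0 ≤ τ v :=
  (hrad v).trans (rad_le_of_isLUB hτ v)

/-- **Children**: if `w` is a child of `v` then `rad v + τ w ≤ τ v` (prepend `v` to the chains from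
`w`). [folklore] -/
theorem rad_add_le_of_isLUB
    (hτ : ∀ v, IsLUB {s : ℝ | ∃ (m : ℕ) (c : ℕ → V), c 0 = v ∧ (∀ i < m, parent (c (i + 1)) = c i) ∧
      (∀ i < m, c (i + 1) ≠ root) ∧ s = ∑ i ∈ range (m + 1), rad (c i)} (τ v))
    {v w : V} (hw : parent w = v) (hw0 : w ≠ root) : rad v + τ w ≤ τ v := by
  suffices h : τ w ≤ τ v - rad v by linarith
  refine (hτ w).2 ?_
  rintro s ⟨m, c, hc0w, hc, hc0, rfl⟩
  -- the chain `v, c 0, c 1, …, c m`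
  set c' : ℕ → V := fun i => Nat.casesOn i v fun j => c j with hc'
  have h1 : ∀ i < m + 1, parent (c' (i + 1)) = c' i := by
    intro i hi
    cases i with
    | zero => show parent (c 0) = v; rw [hc0w, hw]
    | succ j => exact hc j (by omega)
  have h2 : ∀ i < m + 1, c' (i + 1) ≠ root := by
    intro i hi
    cases i with
    | zero => show c 0 ≠ root; rwa [hc0w]
    | succ j => exact hc0 j (by omega)
  have h := (hτ v).1 ⟨m + 1, c', rfl, h1, h2, rfl⟩
  rw [sum_range_succ'] at h
  change ∑ i ∈ range (m + 1), rad (c i) + rad v ≤ τ v at h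
  linarith

/-- **Children**: if `b ≥ 0` bounds `τ` on the children of `v` then `τ v ≤ rad v + b` (a chain from
`v` is `v` followed by a chain from a child). [folklore] -/
theorem le_rad_add_of_isLUB
    (hτ : ∀ v, IsLUB {s : ℝ | ∃ (m : ℕ) (c : ℕ → V), c 0 = v ∧ (∀ i < m, parent (c (i + 1)) = c i) ∧
      (∀ i < m, c (i + 1) ≠ root) ∧ s = ∑ i ∈ range (m + 1), rad (c i)} (τ v))
    {v : V} {b : ℝ} (hb : 0 ≤ b) (hch : ∀ w, parent w = v → w ≠ root → τ w ≤ b) :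
    τ v ≤ rad v + b := by
  refine (hτ v).2 ?_
  rintro s ⟨m, c, hc0v, hc, hc0, rfl⟩
  cases m with
  | zero => simpa [hc0v] using hb
  | succ m =>
    have hd : ∀ i < m, parent (c (i + 1 + 1)) = c (i + 1) := fun i hi => hc (i + 1) (by omega)
    have hd0 : ∀ i < m, c (i + 1 + 1) ≠ root := fun i hi => hc0 (i + 1) (by omega)
    have htail : ∑ i ∈ range (m + 1), rad (c (i + 1)) ≤ τ (c 1) :=
      (hτ (c 1)).1 ⟨m, fun i => c (i + 1), rfl, hd, hd0, rfl⟩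
    have hchild : τ (c 1) ≤ b := hch (c 1) (by rw [hc 0 (by omega), hc0v]) (hc0 0 (by omega))
    show ∑ i ∈ range (m + 1 + 1), rad (c i) ≤ rad v + b
    rw [sum_range_succ', hc0v]
    linarith

/-- **The greedy recursion**: if `v` has a child and `g v` is a child maximising `τ`, then
`τ v = rad v + τ (g v)`. [folklore] -/
theorem eq_rad_add_of_isLUB (hrad : ∀ v, 0 ≤ rad v)
    (hτ : ∀ v, IsLUB {s : ℝ | ∃ (m : ℕ) (c : ℕ → V), c 0 = v ∧ (∀ i < m, parent (c (i + 1)) = c i) ∧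
      (∀ i < m, c (i + 1) ≠ root) ∧ s = ∑ i ∈ range (m + 1), rad (c i)} (τ v))
    (hg : ∀ v, (∃ w, parent w = v ∧ w ≠ root) →
      parent (g v) = v ∧ g v ≠ root ∧ ∀ w, parent w = v → w ≠ root → τ w ≤ τ (g v))
    {v : V} (hv : ∃ w, parent w = v ∧ w ≠ root) : τ v = rad v + τ (g v) := by
  obtain ⟨h1, h2, h3⟩ := hg v hv
  exact le_antisymm (le_rad_add_of_isLUB hτ (nonneg_of_isLUB hrad hτ _) h3)
    (rad_add_le_of_isLUB hτ h1 h2)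

/-- **Leaves**: if `v` has no child then `τ v = rad v`. [folklore] -/
theorem eq_rad_of_isLUB
    (hτ : ∀ v, IsLUB {s : ℝ | ∃ (m : ℕ) (c : ℕ → V), c 0 = v ∧ (∀ i < m, parent (c (i + 1)) = c i) ∧
      (∀ i < m, c (i + 1) ≠ root) ∧ s = ∑ i ∈ range (m + 1), rad (c i)} (τ v))
    {v : V} (hv : ¬ ∃ w, parent w = v ∧ w ≠ root) : τ v = rad v := by
  refine le_antisymm ?_ (rad_le_of_isLUB hτ v)
  have := le_rad_add_of_isLUB hτ (v := v) le_rfl fun w hw hw0 => (hv ⟨w, hw, hw0⟩).elim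
  simpa using this

/-- Along the greedy chain, while children exist ("active" indices), consecutive vertices are
parent and child. [folklore] -/
theorem iterate_greedy_chain
    (hg : ∀ v, (∃ w, parent w = v ∧ w ≠ root) →
      parent (g v) = v ∧ g v ≠ root ∧ ∀ w, parent w = v → w ≠ root → τ w ≤ τ (g v))
    {v : V} {n : ℕ} (hact : ∀ i < n, ∃ w, parent w = g^[i] v ∧ w ≠ root) :
    (∀ i < n, parent (g^[i + 1] v) = g^[i] v) ∧ ∀ i < n, g^[i + 1] v ≠ root := by
  refine ⟨fun i hi => ?_, fun i hi => ?_⟩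
  · rw [Function.iterate_succ_apply']
    exact (hg _ (hact i hi)).1
  · rw [Function.iterate_succ_apply']
    exact (hg _ (hact i hi)).2.1

/-- **The greedy recursion, iterated**: while children exist,
`τ v = Σ_{j<n} rad (g^[j] v) + τ (g^[n] v)`. [cite: JonesSmirnov2000, §3 proof of Thm. 2 (p. 274)] -/
theorem eq_sum_add_iterate_of_isLUB (hrad : ∀ v, 0 ≤ rad v)
    (hτ : ∀ v, IsLUB {s : ℝ | ∃ (m : ℕ) (c : ℕ → V), c 0 = v ∧ (∀ i < m, parent (c (i + 1)) = c i) ∧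
      (∀ i < m, c (i + 1) ≠ root) ∧ s = ∑ i ∈ range (m + 1), rad (c i)} (τ v))
    (hg : ∀ v, (∃ w, parent w = v ∧ w ≠ root) →
      parent (g v) = v ∧ g v ≠ root ∧ ∀ w, parent w = v → w ≠ root → τ w ≤ τ (g v))
    {v : V} : ∀ {n : ℕ}, (∀ i < n, ∃ w, parent w = g^[i] v ∧ w ≠ root) →
      τ v = ∑ j ∈ range n, rad (g^[j] v) + τ (g^[n] v)
  | 0, _ => by simp
  | n + 1, hact => by
    have ih := eq_sum_add_iterate_of_isLUB hrad hτ hg (n := n) fun i hi => hact i (by omega)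
    rw [ih, sum_range_succ, Function.iterate_succ_apply',
      eq_rad_add_of_isLUB hrad hτ hg (hact n (Nat.lt_succ_self n))]
    ring

/-- **`τ v` is the sum of the radii along the greedy chain** (finite or infinite): with
`A = {j | ∀ i < j, g^[i] v has a child}` the set of active indices,
`τ v = Σ_j 𝟙_A(j) rad (g^[j] v)`. If all indices are active the partial sums are
`τ v - τ (g^[n] v) → τ v` (`τ (g^[n] v) ≤ √M √(2/(q v + n + 1)) → 0`); otherwise the chain ends at
a leaf `g^[K] v` with `τ = rad` there. [cite: JonesSmirnov2000, §3 proof of Thm. 2 (p. 274)] -/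
theorem hasSum_indicator_of_isLUB (hq : ∀ v, v ≠ root → q v = q (parent v) + 1)
    (hrad : ∀ v, 0 ≤ rad v) (hsum : Summable fun v => ((q v : ℝ) + 1) ^ 2 * rad v ^ 2)
    (hτ : ∀ v, IsLUB {s : ℝ | ∃ (m : ℕ) (c : ℕ → V), c 0 = v ∧ (∀ i < m, parent (c (i + 1)) = c i) ∧
      (∀ i < m, c (i + 1) ≠ root) ∧ s = ∑ i ∈ range (m + 1), rad (c i)} (τ v))
    (hg : ∀ v, (∃ w, parent w = v ∧ w ≠ root) →
      parent (g v) = v ∧ g v ≠ root ∧ ∀ w, parent w = v → w ≠ root → τ w ≤ τ (g v)) (v : V) :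
    HasSum ({j : ℕ | ∀ i < j, ∃ w, parent w = g^[i] v ∧ w ≠ root}.indicator
      fun j => rad (g^[j] v)) (τ v) := by
  classical
  set A : Set ℕ := {j : ℕ | ∀ i < j, ∃ w, parent w = g^[i] v ∧ w ≠ root} with hA
  have hAmono : ∀ {j k}, k ≤ j → j ∈ A → k ∈ A := fun hkj hj i hi => hj i (by omega)
  have h0A : 0 ∈ A := fun i hi => (Nat.not_lt_zero i hi).elim
  by_cases hall : ∀ n, n ∈ A
  · -- infinite greedy chain: all indices active
    have hind : A.indicator (fun j => rad (g^[j] v)) = fun j => rad (g^[j] v) :=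
      funext fun j => indicator_of_mem (hall j) _
    rw [hind, hasSum_iff_tendsto_nat_of_nonneg (fun j => hrad _)]
    have hpart : ∀ n, ∑ j ∈ range n, rad (g^[j] v) = τ v - τ (g^[n] v) := fun n => by
      rw [eq_sum_add_iterate_of_isLUB hrad hτ hg (hall n)]
      ring
    simp_rw [hpart]
    rw [show 𝓝 (τ v) = 𝓝 (τ v - 0) by rw [sub_zero]]
    refine tendsto_const_nhds.sub ?_
    -- `τ (g^[n] v) → 0`
    set M : ℝ := ∑' u, ((q u : ℝ) + 1) ^ 2 * rad u ^ 2 with hM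
    have hlevel : ∀ n, q (g^[n] v) = q v + n := fun n => by
      have hch := iterate_greedy_chain hg (hall n)
      have := q_apply_chain hq (c := fun j => g^[j] v) hch.1 hch.2 n le_rfl
      simpa using this
    have hbd : ∀ n, τ (g^[n] v) ≤ Real.sqrt M * Real.sqrt (2 / ((q v : ℝ) + n + 1)) := fun n => by
      have := le_sqrt_mul_of_isLUB hq hrad hsum hτ (g^[n] v)
      rw [hlevel n] at this
      push_cast at this
      exact this
    have hlim : Tendsto (fun n : ℕ => Real.sqrt M * Real.sqrt (2 / ((q v : ℝ) + n + 1))) atTop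
        (𝓝 0) := by
      have h1 : Tendsto (fun n : ℕ => 2 / ((q v : ℝ) + n + 1)) atTop (𝓝 0) := by
        have : Tendsto (fun n : ℕ => ((q v : ℝ) + n + 1)) atTop atTop := by
          refine tendsto_atTop_add_const_right _ _ ?_
          exact tendsto_atTop_add_const_left _ _ tendsto_natCast_atTop_atTop
        exact tendsto_const_nhds.div_atTop this
      simpa using (h1.sqrt).const_mul (Real.sqrt M)
    exact squeeze_zero (fun n => nonneg_of_isLUB hrad hτ _) hbd hlim
  · -- the greedy chain ends at a leaf `g^[K] v`
    push Not at hall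
    obtain ⟨N, hN, hNmin⟩ : ∃ N, N ∉ A ∧ ∀ j < N, j ∈ A :=
      ⟨Nat.find hall, Nat.find_spec hall, fun j hj => not_not.1 (Nat.find_min hall hj)⟩
    obtain ⟨K, rfl⟩ : ∃ K, N = K + 1 := ⟨N - 1, by
      have : N ≠ 0 := fun h => hN (h ▸ h0A)
      omega⟩
    have hK : K ∈ A := hNmin K (Nat.lt_succ_self K)
    -- `g^[K] v` is a leaf
    have hleaf : ¬ ∃ w, parent w = g^[K] v ∧ w ≠ root := by
      intro h
      exact hN fun i hi => by
        rcases Nat.lt_succ_iff_lt_or_eq.1 hi with hi | rfl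
        · exact hK i hi
        · exact h
    -- membership in `A` is `j ≤ K`
    have hmem : ∀ j, j ∈ A ↔ j ≤ K := fun j =>
      ⟨fun hj => by
        by_contra h
        exact hleaf (hj K (by omega)), fun hj => hAmono hj hK⟩
    have hτv : τ v = ∑ j ∈ range (K + 1), rad (g^[j] v) := by
      rw [eq_sum_add_iterate_of_isLUB hrad hτ hg hK, eq_rad_of_isLUB hτ hleaf, sum_range_succ]
    rw [hτv]
    have hsupp : ∀ j ∉ range (K + 1), A.indicator (fun j => rad (g^[j] v)) j = 0 := fun j hj => by
      rw [indicator_of_notMem]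
      rw [hmem]
      simpa [Nat.lt_succ_iff] using hj
    have heq : ∑ j ∈ range (K + 1), rad (g^[j] v) =
        ∑ j ∈ range (K + 1), A.indicator (fun j => rad (g^[j] v)) j := by
      refine sum_congr rfl fun j hj => ?_
      rw [indicator_of_mem]
      rw [hmem]
      simpa [Nat.lt_succ_iff] using hj
    rw [heq]
    exact hasSum_sum_of_ne_finset_zero hsupp

end TailSup

/-! ### Telescoping inequalities -/

/-- `1/(k √k) ≤ 2/√(k-1) - 2/√k` for `k ≥ 2`. [folklore] -/
theorem one_div_mul_sqrt_le {k : ℝ} (hk : 2 ≤ k) :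
    1 / (k * Real.sqrt k) ≤ 2 / Real.sqrt (k - 1) - 2 / Real.sqrt k := by
  have hk0 : 0 < k := by linarith
  have hk1 : 0 < k - 1 := by linarith
  set a := Real.sqrt k with ha
  set b := Real.sqrt (k - 1) with hb
  have ha0 : 0 < a := Real.sqrt_pos.2 hk0
  have hb0 : 0 < b := Real.sqrt_pos.2 hk1
  have ha2 : a ^ 2 = k := Real.sq_sqrt hk0.le
  have hb2 : b ^ 2 = k - 1 := Real.sq_sqrt hk1.le
  have hba : b ≤ a := Real.sqrt_le_sqrt (by linarith)
  have hab : (a - b) * (a + b) = 1 := by nlinarith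
  rw [← sub_nonneg]
  have hrw : 2 / b - 2 / a - 1 / (k * a) = (2 * k * (a - b) - b) / (k * a * b) := by
    field_simp
  rw [hrw]
  refine div_nonneg ?_ (by positivity)
  -- `(2 k (a - b) - b)(a + b) = k + 1 - a b ≥ 1`
  have hnum : (2 * k * (a - b) - b) * (a + b) = k + 1 - a * b := by
    linear_combination (2 * k) * hab - hb2
  have hpos : 0 < (2 * k * (a - b) - b) * (a + b) := by
    rw [hnum]
    nlinarith
  exact (pos_of_mul_pos_left hpos (by positivity)).le

/-- `1/√l ≤ 2 (√l - √(l-1))` for `l ≥ 1`. [folklore] -/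
theorem one_div_sqrt_le {l : ℝ} (hl : 1 ≤ l) :
    1 / Real.sqrt l ≤ 2 * (Real.sqrt l - Real.sqrt (l - 1)) := by
  have hl0 : 0 < l := by linarith
  set a := Real.sqrt l with ha
  set b := Real.sqrt (l - 1) with hb
  have ha0 : 0 < a := Real.sqrt_pos.2 hl0
  have hb0 : 0 ≤ b := Real.sqrt_nonneg _
  have ha2 : a ^ 2 = l := Real.sq_sqrt hl0.le
  have hb2 : b ^ 2 = l - 1 := Real.sq_sqrt (by linarith)
  have hba : b ≤ a := Real.sqrt_le_sqrt (by linarith)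
  have hab : (a - b) * (a + b) = 1 := by nlinarith
  rw [div_le_iff₀ ha0]
  nlinarith

/-- `Σ_{j<n} ((m+1+j) √(m+1+j))⁻¹ ≤ 3/√(m+1)` (`≈ Σ_{k > m} k^{-3/2} ≤ 3 (m+1)^{-1/2}`). [folklore] -/
theorem sum_range_one_div_mul_sqrt_le (m n : ℕ) :
    ∑ j ∈ range n, 1 / (((m : ℝ) + 1 + j) * Real.sqrt ((m : ℝ) + 1 + j)) ≤
      3 / Real.sqrt ((m : ℝ) + 1) := by
  have hm : (0 : ℝ) < (m : ℝ) + 1 := by positivity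
  have hsq : 0 < Real.sqrt ((m : ℝ) + 1) := Real.sqrt_pos.2 hm
  cases n with
  | zero => simp; positivity
  | succ n =>
    rw [sum_range_succ']
    -- the first term
    have h0 : 1 / (((m : ℝ) + 1 + ((0 : ℕ) : ℝ)) * Real.sqrt ((m : ℝ) + 1 + ((0 : ℕ) : ℝ))) ≤
        1 / Real.sqrt ((m : ℝ) + 1) := by
      rw [Nat.cast_zero, add_zero]
      refine one_div_le_one_div_of_le hsq ?_
      nlinarith [Real.sqrt_nonneg ((m : ℝ) + 1)]
    -- the telescoping tail
    set F : ℕ → ℝ := fun j => 2 / Real.sqrt ((m : ℝ) + 1 + j) with hF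
    have htail : ∑ j ∈ range n, 1 / (((m : ℝ) + 1 + ((j + 1 : ℕ) : ℝ)) *
        Real.sqrt ((m : ℝ) + 1 + ((j + 1 : ℕ) : ℝ))) ≤ ∑ j ∈ range n, (F j - F (j + 1)) := by
      refine sum_le_sum fun j _ => ?_
      have := one_div_mul_sqrt_le (k := (m : ℝ) + 1 + (j + 1 : ℕ)) (by push_cast; linarith)
      simp only [hF]
      push_cast at this ⊢
      rw [show (m : ℝ) + 1 + (j + 1) - 1 = (m : ℝ) + 1 + j by ring] at this
      exact this
    rw [Finset.sum_range_sub'] at htail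
    have hF0 : F 0 = 2 / Real.sqrt ((m : ℝ) + 1) := by simp [hF]
    have hFn : 0 ≤ F n := by simp only [hF]; positivity
    calc _ ≤ (F 0 - F n) + 1 / Real.sqrt ((m : ℝ) + 1) := add_le_add htail h0
      _ ≤ 2 / Real.sqrt ((m : ℝ) + 1) + 1 / Real.sqrt ((m : ℝ) + 1) := by rw [hF0]; linarith
      _ = 3 / Real.sqrt ((m : ℝ) + 1) := by ring

/-- `Σ_{l ≤ n} (√(l+1))⁻¹ ≤ 2 √(n+1)`. [folklore] -/
theorem sum_range_one_div_sqrt_le (n : ℕ) :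
    ∑ l ∈ range (n + 1), 1 / Real.sqrt ((l : ℝ) + 1) ≤ 2 * Real.sqrt ((n : ℝ) + 1) := by
  set G : ℕ → ℝ := fun l => 2 * Real.sqrt (l : ℝ) with hG
  have h : ∀ l ∈ range (n + 1), 1 / Real.sqrt ((l : ℝ) + 1) ≤ G (l + 1) - G l := fun l _ => by
    have := one_div_sqrt_le (l := (l : ℝ) + 1) (by linarith [l.cast_nonneg (α := ℝ)])
    simp only [hG]
    push_cast
    rw [add_sub_cancel_right] at this
    linarith
  calc ∑ l ∈ range (n + 1), 1 / Real.sqrt ((l : ℝ) + 1) ≤ ∑ l ∈ range (n + 1), (G (l + 1) - G l) :=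
        sum_le_sum h
    _ = G (n + 1) - G 0 := Finset.sum_range_sub G (n + 1)
    _ = 2 * Real.sqrt ((n : ℝ) + 1) := by simp [hG]


end Literature.Probability.RandomPlanarGeometry
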